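import Mathlib
import Summits.Ventures.PercRepro2.SwOutMixedArmsBaseClasses

/-!
# The several-arms base: the realisation on each class (blind cell PercRepro2, night-4 g20,
2026-08-27; proofs/NIGHT4-G20.md §4′)

The value of `mixedRealR σ q` on each edge class of a `MixedBaseR`: the base value when the class's
coordinate is `true`, the flipped value when it is `false` (`mixedRealR_apply_U` / `_Ah` / `_UP` /
`_Ext` / `_F`), and the base value off every class (`mixedRealR_apply_none`) — by the disjointness
of the classes (`SwOutMixedArmsBaseClasses`); hence the realisation is INJECTIVE when every class
has an edge (`mixedRealR_injective`, the hypothesis `hr` of `card_le_of_mixedArms_edges`).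
-/

namespace Summit.Ventures.PercRepro2

namespace MixedArms

open Hull LocRows

variable {V : Type*} {E : Type*}

open scoped Classical

section Base

variable {ends : E → Sym2 V} {σ : Config E} {h u : V} {ι ρ ν κ : Type*} {U : ι → Set V}
  {p : ρ → V} {Ah : ν → Set V} {arm : ν → ρ} {F : κ → Set V}
  (hb : MixedBaseR ends σ h u U p Ah arm F)
include hb

/-- On an edge touching `U j`. -/
lemma MixedBaseR.mixedRealR_apply_U {q : PtR ι ρ ν κ} {j : ι} {e : E}
    (he : e ∈ touches ends (U j)) :
    mixedRealR ends u U p Ah F σ q e = (if q.1 j = true then σ e else !σ e) := by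
  unfold mixedRealR
  by_cases hj : q.1 j = true
  · rw [if_pos hj, if_neg]
    rintro ((((⟨j', hj', he'⟩ | ⟨i, _, he'⟩) | ⟨r, _, he'⟩) | ⟨r, _, he'⟩) | ⟨k, _, he'⟩)
    · by_cases hjj : j = j'
      · subst hjj
        rw [hj] at hj'
        exact absurd hj' (by decide)
      · exact hb.touches_U_disj hjj he he'
    · exact hb.touches_U_Ah_disj he he'
    · exact (hb.clsUPR_not_touches he').1 j he
    · exact (hb.clsExtR_not_touches he').1 j he
    · exact hb.touches_U_F_disj he he'
  · rw [if_neg hj, if_pos]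
    exact Or.inl (Or.inl (Or.inl (Or.inl ⟨j, by simpa using hj, he⟩)))

/-- On an edge touching the piece `Ah i`. -/
lemma MixedBaseR.mixedRealR_apply_Ah {q : PtR ι ρ ν κ} {i : ν} {e : E}
    (he : e ∈ touches ends (Ah i)) :
    mixedRealR ends u U p Ah F σ q e = (if q.2.1 i = true then σ e else !σ e) := by
  unfold mixedRealR
  by_cases hi : q.2.1 i = true
  · rw [if_pos hi, if_neg]
    rintro ((((⟨j, _, he'⟩ | ⟨i', hi', he'⟩) | ⟨r, _, he'⟩) | ⟨r, _, he'⟩) | ⟨k, _, he'⟩)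
    · exact hb.touches_U_Ah_disj he' he
    · by_cases hii : i = i'
      · subst hii
        rw [hi] at hi'
        exact absurd hi' (by decide)
      · exact hb.touches_Ah_disj hii he he'
    · exact (hb.clsUPR_not_touches he').2.1 i he
    · exact (hb.clsExtR_not_touches he').2.1 i he
    · exact hb.touches_Ah_F_disj he he'
  · rw [if_neg hi, if_pos]
    exact Or.inl (Or.inl (Or.inl (Or.inr ⟨i, by simpa using hi, he⟩)))

/-- On a u–`p r` edge. -/
lemma MixedBaseR.mixedRealR_apply_UP {q : PtR ι ρ ν κ} {r : ρ} {e : E}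
    (he : e ∈ clsUPR ends u p r) :
    mixedRealR ends u U p Ah F σ q e = (if q.2.2.1 r = true then σ e else !σ e) := by
  unfold mixedRealR
  by_cases hr : q.2.2.1 r = true
  · rw [if_pos hr, if_neg]
    rintro ((((⟨j, _, he'⟩ | ⟨i, _, he'⟩) | ⟨r', hr', he'⟩) | ⟨r', _, he'⟩) | ⟨k, _, he'⟩)
    · exact (hb.clsUPR_not_touches he).1 j he'
    · exact (hb.clsUPR_not_touches he).2.1 i he'
    · by_cases hrr : r' = r
      · subst hrr
        rw [hr] at hr'
        exact absurd hr' (by decide)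
      · exact (hb.clsUPR_not_touches he).2.2.2 r' hrr he'
    · exact (hb.clsExtR_not_touches he').2.2.2.1 r he
    · exact (hb.clsUPR_not_touches he).2.2.1 k he'
  · rw [if_neg hr, if_pos]
    exact Or.inl (Or.inl (Or.inr ⟨r, by simpa using hr, he⟩))

/-- On an outside edge of `p r`. -/
lemma MixedBaseR.mixedRealR_apply_Ext {q : PtR ι ρ ν κ} {r : ρ} {e : E}
    (he : e ∈ clsExtR ends u p Ah r) :
    mixedRealR ends u U p Ah F σ q e = (if q.2.2.2.1 r = true then σ e else !σ e) := by
  unfold mixedRealR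
  by_cases hr : q.2.2.2.1 r = true
  · rw [if_pos hr, if_neg]
    rintro ((((⟨j, _, he'⟩ | ⟨i, _, he'⟩) | ⟨r', _, he'⟩) | ⟨r', hr', he'⟩) | ⟨k, _, he'⟩)
    · exact (hb.clsExtR_not_touches he).1 j he'
    · exact (hb.clsExtR_not_touches he).2.1 i he'
    · exact (hb.clsExtR_not_touches he).2.2.2.1 r' he'
    · by_cases hrr : r' = r
      · subst hrr
        rw [hr] at hr'
        exact absurd hr' (by decide)
      · exact (hb.clsExtR_not_touches he).2.2.2.2 r' hrr he'
    · exact (hb.clsExtR_not_touches he).2.2.1 k he'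
  · rw [if_neg hr, if_pos]
    exact Or.inl (Or.inr ⟨r, by simpa using hr, he⟩)

/-- On an edge touching `F k`. -/
lemma MixedBaseR.mixedRealR_apply_F {q : PtR ι ρ ν κ} {k : κ} {e : E}
    (he : e ∈ touches ends (F k)) :
    mixedRealR ends u U p Ah F σ q e = (if q.2.2.2.2 k = true then σ e else !σ e) := by
  unfold mixedRealR
  by_cases hk : q.2.2.2.2 k = true
  · rw [if_pos hk, if_neg]
    rintro ((((⟨j, _, he'⟩ | ⟨i, _, he'⟩) | ⟨r, _, he'⟩) | ⟨r, _, he'⟩) | ⟨k', hk', he'⟩)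
    · exact hb.touches_U_F_disj he' he
    · exact hb.touches_Ah_F_disj he' he
    · exact (hb.clsUPR_not_touches he').2.2.1 k he
    · exact (hb.clsExtR_not_touches he').2.2.1 k he
    · by_cases hkk : k = k'
      · subst hkk
        rw [hk] at hk'
        exact absurd hk' (by decide)
      · exact hb.touches_F_disj hkk he he'
  · rw [if_neg hk, if_pos]
    exact Or.inr ⟨k, by simpa using hk, he⟩

omit hb in
/-- On an edge in no class. -/
lemma MixedBaseR.mixedRealR_apply_none {q : PtR ι ρ ν κ} {e : E}
    (hU : ∀ j, e ∉ touches ends (U j)) (hA : ∀ i, e ∉ touches ends (Ah i))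
    (hUP : ∀ r, e ∉ clsUPR ends u p r) (hX : ∀ r, e ∉ clsExtR ends u p Ah r)
    (hF : ∀ k, e ∉ touches ends (F k)) : mixedRealR ends u U p Ah F σ q e = σ e := by
  unfold mixedRealR
  rw [if_neg]
  rintro ((((⟨j, _, he⟩ | ⟨i, _, he⟩) | ⟨r, _, he⟩) | ⟨r, _, he⟩) | ⟨k, _, he⟩)
  · exact hU j he
  · exact hA i he
  · exact hUP r he
  · exact hX r he
  · exact hF k he

end Base

section Inj

variable {ends : E → Sym2 V} {σ : Config E} {h u : V} {ι ρ ν κ : Type*} {U : ι → Set V}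
  {p : ρ → V} {Ah : ν → Set V} {arm : ν → ρ} {F : κ → Set V}

/-- Two points with the same realisation agree on a class with an edge. -/
lemma coord_eq_of_mixedRealR_eq {q q' : PtR ι ρ ν κ}
    (hqq : mixedRealR ends u U p Ah F σ q = mixedRealR ends u U p Ah F σ q') {e : E}
    {b b' : Bool} (hq : mixedRealR ends u U p Ah F σ q e = (if b = true then σ e else !σ e))
    (hq' : mixedRealR ends u U p Ah F σ q' e = (if b' = true then σ e else !σ e)) : b = b' := by
  have := congrFun hqq e
  rw [hq, hq'] at this
  cases b <;> cases b' <;> simp_all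

variable (hb : MixedBaseR ends σ h u U p Ah arm F)
include hb

/-- **The realisation is injective** when every class has an edge: a u–`p r` edge and an outside
edge at every dropped vertex, an edge at every piece and at every far arm. -/
theorem MixedBaseR.mixedRealR_injective (hup : ∀ r, ∃ e, ends e = s(u, p r))
    (hAe : ∀ i, ∃ e, e ∈ touches ends (Ah i)) (hFe : ∀ k, ∃ e, e ∈ touches ends (F k))
    (hext : ∀ r, ∃ e, e ∈ clsExtR ends u p Ah r) :
    Function.Injective (mixedRealR ends u U p Ah F σ : PtR ι ρ ν κ → Config E) := by
  intro q q' hqq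
  obtain ⟨s, a, uP, e, f⟩ := q
  obtain ⟨s', a', uP', e', f'⟩ := q'
  simp only [Prod.mk.injEq]
  refine ⟨?_, ?_, ?_, ?_, ?_⟩
  · funext j
    obtain ⟨e₀, x, hex, hx⟩ := hb.u_adj_U j
    have ht : e₀ ∈ touches ends (U j) := ⟨x, hx, u, ends_swap hex⟩
    exact coord_eq_of_mixedRealR_eq hqq (hb.mixedRealR_apply_U ht) (hb.mixedRealR_apply_U ht)
  · funext i
    obtain ⟨e₀, ht⟩ := hAe i
    exact coord_eq_of_mixedRealR_eq hqq (hb.mixedRealR_apply_Ah ht) (hb.mixedRealR_apply_Ah ht)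
  · funext r
    obtain ⟨e₀, hup'⟩ := hup r
    exact coord_eq_of_mixedRealR_eq hqq (hb.mixedRealR_apply_UP hup')
      (hb.mixedRealR_apply_UP hup')
  · funext r
    obtain ⟨e₀, hx⟩ := hext r
    exact coord_eq_of_mixedRealR_eq hqq (hb.mixedRealR_apply_Ext hx) (hb.mixedRealR_apply_Ext hx)
  · funext k
    obtain ⟨e₀, ht⟩ := hFe k
    exact coord_eq_of_mixedRealR_eq hqq (hb.mixedRealR_apply_F ht) (hb.mixedRealR_apply_F ht)

end Inj

end MixedArms

end Summit.Ventures.PercRepro2
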